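import Mathlib.Analysis.SpecialFunctions.Pow.Deriv
import Mathlib.Analysis.Polynomial.Basic
import Mathlib.Analysis.Calculus.Deriv.Polynomial
import Mathlib.Analysis.Calculus.Deriv.MeanValue

/-!
# SoloInformedRootConvexity — the `k`-th root of a real polynomial of degree `d ∈ (k, 2k)` is convex with
second derivative `≍ t^{d/k - 2} → 0`

Solo unit `solo-Parity-informed` (ideation tier, informed mode), session 15; `PLAN.md` §23, CLAIMS C65.

For `G ∈ ℝ[X]` with positive leading coefficient `a`, degree `d`, and an exponent `k` with `k < d`, put
`φ(t) = G(t)^{1/k}` (`polyRootFun`).  Then `φ'' = k⁻² G^{1/k-2} · H` with the CONVEXITY POLYNOMIAL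
`H = k G G'' - (k-1) G'²` (`convexityPoly`) of degree `2d - 2` and leading coefficient `a² d (d - k) > 0`
(`natDegree_convexityPoly`, `leadingCoeff_convexityPoly`), so that for `t ≥ T₁`:
`0 < φ''(t) ≤ M t^{d/k - 2}` (`exists_polyRootFunDD_pos_le`); and by three applications of Lagrange's mean value
theorem the chord slopes of `φ` over `T₁ ≤ x < y < z` increase, by at most `M x^{d/k-2} (z - x)`
(`exists_polyRootFun_slope_sub_slope_eq`, `polyRootFun_slope_sub_slope_mem`).  When `d < 2k` the exponent `d/k - 2` is negative:
this is the input of the Jarník-type count `SoloInformedMidPowerValues`.  Mathlib only.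
-/

namespace Summit.Parity.BatemanHorn.Theorems

open Polynomial Filter Asymptotics Set
open scoped Topology

/-! ### The root function and its first two derivatives -/

/-- `φ(t) = G(t)^r`. -/
noncomputable def polyRootFun (G : ℝ[X]) (r : ℝ) (t : ℝ) : ℝ := (G.eval t) ^ r

/-- `φ'(t) = G'(t) · r · G(t)^{r-1}`. -/
noncomputable def polyRootFunD (G : ℝ[X]) (r : ℝ) (t : ℝ) : ℝ :=
  (derivative G).eval t * r * (G.eval t) ^ (r - 1)

/-- `φ''(t)` (product rule applied to `polyRootFunD`). -/
noncomputable def polyRootFunDD (G : ℝ[X]) (r : ℝ) (t : ℝ) : ℝ :=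
  (derivative (derivative G)).eval t * r * (G.eval t) ^ (r - 1)
    + (derivative G).eval t * r * ((derivative G).eval t * (r - 1) * (G.eval t) ^ (r - 1 - 1))

/-- The convexity polynomial `H = k G G'' - (k - 1) G'²`. -/
noncomputable def convexityPoly (G : ℝ[X]) (k : ℕ) : ℝ[X] :=
  C (k : ℝ) * (G * derivative (derivative G)) - C ((k : ℝ) - 1) * (derivative G) ^ 2

/-- `φ` has derivative `φ'` where `G ≠ 0`. -/
theorem hasDerivAt_polyRootFun (G : ℝ[X]) (r : ℝ) {t : ℝ} (ht : G.eval t ≠ 0) :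
    HasDerivAt (polyRootFun G r) (polyRootFunD G r t) t := by
  unfold polyRootFun polyRootFunD
  exact (G.hasDerivAt t).rpow_const (Or.inl ht)

/-- `φ'` has derivative `φ''` where `G ≠ 0`. -/
theorem hasDerivAt_polyRootFunD (G : ℝ[X]) (r : ℝ) {t : ℝ} (ht : G.eval t ≠ 0) :
    HasDerivAt (polyRootFunD G r) (polyRootFunDD G r t) t := by
  have h1 : HasDerivAt (fun t => (derivative G).eval t * r)
      ((derivative (derivative G)).eval t * r) t :=
    ((derivative G).hasDerivAt t).mul_const r
  have h2 : HasDerivAt (fun t => (G.eval t) ^ (r - 1))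
      ((derivative G).eval t * (r - 1) * (G.eval t) ^ (r - 1 - 1)) t :=
    (G.hasDerivAt t).rpow_const (Or.inl ht)
  have h := h1.mul h2
  exact h

/-- Closed form: `φ'' = k⁻² · G^{1/k - 2} · H` where `G > 0`. -/
theorem polyRootFunDD_eq (G : ℝ[X]) {k : ℕ} (hk : k ≠ 0) {t : ℝ} (ht : 0 < G.eval t) :
    polyRootFunDD G (k : ℝ)⁻¹ t
      = ((k : ℝ)⁻¹) ^ 2 * (G.eval t) ^ ((k : ℝ)⁻¹ - 2) * (convexityPoly G k).eval t := by
  unfold polyRootFunDD convexityPoly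
  have hk0 : (k : ℝ) ≠ 0 := by exact_mod_cast hk
  have h1 : (G.eval t) ^ ((k : ℝ)⁻¹ - 1) = (G.eval t) ^ ((k : ℝ)⁻¹ - 2) * G.eval t := by
    rw [show (k : ℝ)⁻¹ - 1 = ((k : ℝ)⁻¹ - 2) + 1 by ring, Real.rpow_add ht, Real.rpow_one]
  have h2 : (G.eval t) ^ ((k : ℝ)⁻¹ - 1 - 1) = (G.eval t) ^ ((k : ℝ)⁻¹ - 2) := by
    rw [show (k : ℝ)⁻¹ - 1 - 1 = (k : ℝ)⁻¹ - 2 by ring]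
  rw [h1, h2]
  simp only [eval_sub, eval_mul, eval_C, eval_pow]
  field_simp
  ring

/-! ### Degree and leading coefficient of the convexity polynomial -/

/-- `deg H ≤ 2d - 2`. -/
theorem natDegree_convexityPoly_le (G : ℝ[X]) (k : ℕ) (hd : 2 ≤ G.natDegree) :
    (convexityPoly G k).natDegree ≤ 2 * G.natDegree - 2 := by
  unfold convexityPoly
  have h1 : (C (k : ℝ) * (G * derivative (derivative G))).natDegree ≤ 2 * G.natDegree - 2 := by
    refine (natDegree_C_mul_le _ _).trans ((natDegree_mul_le).trans ?_)
    rw [natDegree_derivative, natDegree_derivative]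
    omega
  have h2 : (C ((k : ℝ) - 1) * (derivative G) ^ 2).natDegree ≤ 2 * G.natDegree - 2 := by
    refine (natDegree_C_mul_le _ _).trans ((natDegree_pow_le).trans ?_)
    rw [natDegree_derivative]
    omega
  exact (natDegree_sub_le _ _).trans (max_le h1 h2)

/-- The coefficient of `t^{2d-2}` in `H` is `a² d (d - k)`. -/
theorem coeff_convexityPoly (G : ℝ[X]) (k : ℕ) (hd : 2 ≤ G.natDegree) :
    (convexityPoly G k).coeff (2 * G.natDegree - 2)
      = G.leadingCoeff ^ 2 * G.natDegree * ((G.natDegree : ℝ) - k) := by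
  unfold convexityPoly
  set d := G.natDegree with hd'
  have hD1 : (derivative G).natDegree = d - 1 := by rw [natDegree_derivative]
  have hD2 : (derivative (derivative G)).natDegree = d - 2 := by
    rw [natDegree_derivative, natDegree_derivative]
    omega
  have hL1 : (derivative G).leadingCoeff = G.leadingCoeff * d := by rw [leadingCoeff_derivative]
  have hL2 : (derivative (derivative G)).leadingCoeff = G.leadingCoeff * d * ((d - 1 : ℕ) : ℝ) := by
    rw [leadingCoeff_derivative, leadingCoeff_derivative, natDegree_derivative]
  have hmul : (G * derivative (derivative G)).coeff (2 * d - 2)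
      = G.leadingCoeff * (G.leadingCoeff * d * ((d - 1 : ℕ) : ℝ)) := by
    rw [show 2 * d - 2 = G.natDegree + (derivative (derivative G)).natDegree by rw [hD2]; omega,
      coeff_mul_degree_add_degree, hL2]
  have hsq : ((derivative G) ^ 2).coeff (2 * d - 2) = (G.leadingCoeff * d) ^ 2 := by
    rw [pow_two, show 2 * d - 2 = (derivative G).natDegree + (derivative G).natDegree by
      rw [hD1]; omega, coeff_mul_degree_add_degree, hL1, pow_two]
  rw [coeff_sub, coeff_C_mul, coeff_C_mul, hmul, hsq]
  have : ((d - 1 : ℕ) : ℝ) = (d : ℝ) - 1 := by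
    rw [Nat.cast_sub (by omega)]
    push_cast
    ring
  rw [this]
  ring

/-- `deg H = 2d - 2` when `k < d` and `a ≠ 0`. -/
theorem natDegree_convexityPoly (G : ℝ[X]) {k : ℕ} (hd : 2 ≤ G.natDegree) (hkd : k < G.natDegree)
    (hlc : G.leadingCoeff ≠ 0) :
    (convexityPoly G k).natDegree = 2 * G.natDegree - 2 := by
  refine natDegree_eq_of_le_of_coeff_ne_zero (natDegree_convexityPoly_le G k hd) ?_
  rw [coeff_convexityPoly G k hd]
  have h1 : (0 : ℝ) < (G.natDegree : ℝ) - k := by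
    have : (k : ℝ) < G.natDegree := by exact_mod_cast hkd
    linarith
  have h2 : (0 : ℝ) < G.natDegree := by exact_mod_cast (show 0 < G.natDegree by omega)
  have h3 : 0 < G.leadingCoeff ^ 2 := by positivity
  positivity

/-- The leading coefficient of `H` is `a² d (d - k)` when `k < d` and `a ≠ 0`. -/
theorem leadingCoeff_convexityPoly (G : ℝ[X]) {k : ℕ} (hd : 2 ≤ G.natDegree) (hkd : k < G.natDegree)
    (hlc : G.leadingCoeff ≠ 0) :
    (convexityPoly G k).leadingCoeff = G.leadingCoeff ^ 2 * G.natDegree * ((G.natDegree : ℝ) - k) := by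
  rw [leadingCoeff, natDegree_convexityPoly G hd hkd hlc, coeff_convexityPoly G k hd]

/-! ### Eventual two-sided bounds for a polynomial with positive leading coefficient -/

/-- `lc/2 · t^n ≤ P(t) ≤ 2 lc · t^n` eventually, for `P` with positive leading coefficient `lc` and degree
`n` (from `Polynomial.isEquivalent_atTop_lead`). -/
theorem eventually_lead_div_two_le_eval (P : ℝ[X]) (hP : 0 < P.leadingCoeff) :
    ∀ᶠ t : ℝ in atTop, P.leadingCoeff / 2 * t ^ P.natDegree ≤ P.eval t
      ∧ P.eval t ≤ 2 * P.leadingCoeff * t ^ P.natDegree := by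
  have h := (P.isEquivalent_atTop_lead).isLittleO.def (show (0 : ℝ) < 1 / 2 by norm_num)
  filter_upwards [h, eventually_gt_atTop 0] with t ht ht0
  have hv : 0 < P.leadingCoeff * t ^ P.natDegree := by positivity
  rw [Pi.sub_apply, Real.norm_eq_abs, Real.norm_eq_abs, abs_of_pos hv] at ht
  obtain ⟨h1, h2⟩ := abs_le.mp ht
  constructor <;> linarith

/-! ### `0 < φ'' ≤ M t^{d/k - 2}` for large `t` -/

/-- **Second-derivative bounds.**  For `G ∈ ℝ[X]` with positive leading coefficient, degree `d ≥ 2`, and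
`0 < k < d`: there are `T₁ ≥ 1` and `M > 0` with `G(t) > 0`, `0 < φ''(t) ≤ M t^{d/k - 2}` for all `t ≥ T₁`,
where `φ = G^{1/k}`. -/
theorem exists_polyRootFunDD_pos_le (G : ℝ[X]) {k : ℕ} (hk : 0 < k) (hd : 2 ≤ G.natDegree)
    (hkd : k < G.natDegree) (hlc : 0 < G.leadingCoeff) :
    ∃ T₁ M : ℝ, 1 ≤ T₁ ∧ 0 < M ∧ ∀ t : ℝ, T₁ ≤ t →
      0 < G.eval t ∧ 0 < polyRootFunDD G (k : ℝ)⁻¹ t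
        ∧ polyRootFunDD G (k : ℝ)⁻¹ t ≤ M * t ^ ((G.natDegree : ℝ) / k - 2) := by
  set d := G.natDegree with hd'
  set a := G.leadingCoeff with ha
  set H := convexityPoly G k with hH
  have hHdeg : H.natDegree = 2 * d - 2 := natDegree_convexityPoly G hd hkd hlc.ne'
  have hHlc : H.leadingCoeff = a ^ 2 * d * ((d : ℝ) - k) := leadingCoeff_convexityPoly G hd hkd hlc.ne'
  have hdk : (0 : ℝ) < (d : ℝ) - k := by
    have : (k : ℝ) < d := by exact_mod_cast hkd
    linarith
  have hd0 : (0 : ℝ) < d := by exact_mod_cast (show 0 < d by omega)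
  have hHlc0 : 0 < H.leadingCoeff := by rw [hHlc]; positivity
  have hk0 : (k : ℝ) ≠ 0 := by exact_mod_cast hk.ne'
  have hkpos : (0 : ℝ) < k := by exact_mod_cast hk
  -- the negative exponent `e = 1/k - 2`
  set e : ℝ := (k : ℝ)⁻¹ - 2 with he
  have he0 : e ≤ 0 := by
    have : (k : ℝ)⁻¹ ≤ 1 := inv_le_one_of_one_le₀ (by exact_mod_cast hk)
    rw [he]; linarith
  obtain ⟨T₁, hT₁⟩ := eventually_atTop.mp ((eventually_lead_div_two_le_eval G hlc).and
    ((eventually_lead_div_two_le_eval H hHlc0).and (eventually_ge_atTop (1 : ℝ))))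
  set M : ℝ := ((k : ℝ)⁻¹) ^ 2 * (a / 2) ^ e * (2 * H.leadingCoeff) with hM
  have hM0 : 0 < M := by
    rw [hM]
    have : 0 < (a / 2) ^ e := Real.rpow_pos_of_pos (by positivity) e
    positivity
  refine ⟨max T₁ 1, M, le_max_right _ _, hM0, fun t ht => ?_⟩
  obtain ⟨⟨hG1, hG2⟩, ⟨hH1, hH2⟩, ht1⟩ := hT₁ t ((le_max_left _ _).trans ht)
  have ht0 : 0 < t := by linarith
  have hGpos : 0 < G.eval t := lt_of_lt_of_le (by positivity) hG1
  have hHpos : 0 < H.eval t := lt_of_lt_of_le (by positivity) hH1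
  rw [← ha] at hG1 hG2
  refine ⟨hGpos, ?_, ?_⟩
  · rw [polyRootFunDD_eq G hk.ne' hGpos, ← hH]
    have : 0 < (G.eval t) ^ ((k : ℝ)⁻¹ - 2) := Real.rpow_pos_of_pos hGpos _
    positivity
  · rw [polyRootFunDD_eq G hk.ne' hGpos, ← hH, ← he]
    -- `G(t)^e ≤ (a/2 · t^d)^e = (a/2)^e · t^{d e}`
    have hGe : (G.eval t) ^ e ≤ (a / 2) ^ e * t ^ ((d : ℝ) * e) := by
      calc (G.eval t) ^ e ≤ (a / 2 * t ^ d) ^ e := Real.rpow_le_rpow_of_nonpos (by positivity) hG1 he0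
        _ = (a / 2) ^ e * (t ^ d) ^ e := Real.mul_rpow (by positivity) (by positivity)
        _ = (a / 2) ^ e * t ^ ((d : ℝ) * e) := by rw [Real.rpow_natCast_mul ht0.le]
    have hHe : H.eval t ≤ 2 * H.leadingCoeff * t ^ (2 * d - 2) := by rw [← hHdeg]; exact hH2
    -- combine the exponents: `d e + (2d - 2) = d/k - 2`
    have hexp : t ^ ((d : ℝ) * e) * t ^ (2 * d - 2) = t ^ ((d : ℝ) / k - 2) := by
      rw [← Real.rpow_natCast t (2 * d - 2), ← Real.rpow_add ht0]
      congr 1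
      rw [Nat.cast_sub (by omega), he]
      push_cast
      field_simp
      ring
    calc ((k : ℝ)⁻¹) ^ 2 * (G.eval t) ^ e * H.eval t
        ≤ ((k : ℝ)⁻¹) ^ 2 * ((a / 2) ^ e * t ^ ((d : ℝ) * e)) * (2 * H.leadingCoeff * t ^ (2 * d - 2)) := by
          gcongr
    _ = M * (t ^ ((d : ℝ) * e) * t ^ (2 * d - 2)) := by rw [hM]; ring
    _ = M * t ^ ((d : ℝ) / k - 2) := by rw [hexp]

/-! ### Chord slopes: three applications of the mean value theorem -/

/-- On `[T₁, ∞)`, where `G > 0`, `φ` is differentiable with derivative `φ'` and `φ'` with derivative `φ''`;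
the chord slopes of `φ` over `x < y < z` differ by `φ''(η)(ξ₂ - ξ₁)` for some `x < ξ₁ < η < ξ₂ < z`. -/
theorem exists_polyRootFun_slope_sub_slope_eq (G : ℝ[X]) (r : ℝ) {T₁ : ℝ}
    (hpos : ∀ t : ℝ, T₁ ≤ t → 0 < G.eval t) {x y z : ℝ} (hx : T₁ ≤ x) (hxy : x < y) (hyz : y < z) :
    ∃ ξ₁ ξ₂ η : ℝ, x < ξ₁ ∧ ξ₁ < η ∧ η < ξ₂ ∧ ξ₂ < z ∧
      (polyRootFun G r z - polyRootFun G r y) / (z - y) - (polyRootFun G r y - polyRootFun G r x) / (y - x)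
        = polyRootFunDD G r η * (ξ₂ - ξ₁) := by
  have hder : ∀ t : ℝ, T₁ ≤ t → HasDerivAt (polyRootFun G r) (polyRootFunD G r t) t :=
    fun t ht => hasDerivAt_polyRootFun G r (hpos t ht).ne'
  have hderD : ∀ t : ℝ, T₁ ≤ t → HasDerivAt (polyRootFunD G r) (polyRootFunDD G r t) t :=
    fun t ht => hasDerivAt_polyRootFunD G r (hpos t ht).ne'
  have hcont : ∀ {u v : ℝ}, T₁ ≤ u → ContinuousOn (polyRootFun G r) (Icc u v) := fun hu =>
    continuousOn_of_forall_continuousAt fun t ht => (hder t (hu.trans ht.1)).continuousAt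
  have hcontD : ∀ {u v : ℝ}, T₁ ≤ u → ContinuousOn (polyRootFunD G r) (Icc u v) := fun hu =>
    continuousOn_of_forall_continuousAt fun t ht => (hderD t (hu.trans ht.1)).continuousAt
  obtain ⟨ξ₁, hξ₁, h₁⟩ := exists_hasDerivAt_eq_slope (polyRootFun G r) (polyRootFunD G r) hxy (hcont hx)
    (fun t ht => hder t (hx.trans ht.1.le))
  obtain ⟨ξ₂, hξ₂, h₂⟩ := exists_hasDerivAt_eq_slope (polyRootFun G r) (polyRootFunD G r) hyz
    (hcont (hx.trans hxy.le)) (fun t ht => hder t ((hx.trans hxy.le).trans ht.1.le))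
  have hξ₁₂ : ξ₁ < ξ₂ := hξ₁.2.trans hξ₂.1
  have hTξ₁ : T₁ ≤ ξ₁ := hx.trans hξ₁.1.le
  obtain ⟨η, hη, h₃⟩ := exists_hasDerivAt_eq_slope (polyRootFunD G r) (polyRootFunDD G r) hξ₁₂ (hcontD hTξ₁)
    (fun t ht => hderD t (hTξ₁.trans ht.1.le))
  refine ⟨ξ₁, ξ₂, η, hξ₁.1, hη.1, hη.2, hξ₂.2, ?_⟩
  rw [← h₁, ← h₂, h₃, div_mul_cancel₀ _ (sub_ne_zero.mpr hξ₁₂.ne')]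

/-- **Chord slopes of `φ = G^{1/k}` increase, by at most `M x^{d/k-2}(z - x)`, over `T₁ ≤ x < y < z`.** -/
theorem polyRootFun_slope_sub_slope_mem (G : ℝ[X]) {k : ℕ} {T₁ M : ℝ} (hT₁ : 1 ≤ T₁)
    (hDD : ∀ t : ℝ, T₁ ≤ t → 0 < G.eval t ∧ 0 < polyRootFunDD G (k : ℝ)⁻¹ t
      ∧ polyRootFunDD G (k : ℝ)⁻¹ t ≤ M * t ^ ((G.natDegree : ℝ) / k - 2))
    (he : (G.natDegree : ℝ) / k - 2 ≤ 0)
    {x y z : ℝ} (hx : T₁ ≤ x) (hxy : x < y) (hyz : y < z) :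
    0 < (polyRootFun G (k : ℝ)⁻¹ z - polyRootFun G (k : ℝ)⁻¹ y) / (z - y)
          - (polyRootFun G (k : ℝ)⁻¹ y - polyRootFun G (k : ℝ)⁻¹ x) / (y - x)
      ∧ (polyRootFun G (k : ℝ)⁻¹ z - polyRootFun G (k : ℝ)⁻¹ y) / (z - y)
          - (polyRootFun G (k : ℝ)⁻¹ y - polyRootFun G (k : ℝ)⁻¹ x) / (y - x)
        ≤ M * x ^ ((G.natDegree : ℝ) / k - 2) * (z - x) := by
  obtain ⟨ξ₁, ξ₂, η, h1, h2, h3, h4, heq⟩ :=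
    exists_polyRootFun_slope_sub_slope_eq G (k : ℝ)⁻¹ (fun t ht => (hDD t ht).1) hx hxy hyz
  rw [heq]
  have hη : T₁ ≤ η := by linarith
  obtain ⟨-, hpos, hle⟩ := hDD η hη
  have hx0 : 0 < x := by linarith
  have hgap : 0 < ξ₂ - ξ₁ := by linarith
  refine ⟨mul_pos hpos hgap, ?_⟩
  have hM : 0 ≤ M := by
    have := hpos.trans_le hle
    have hpow : 0 < η ^ ((G.natDegree : ℝ) / k - 2) := Real.rpow_pos_of_pos (by linarith) _
    nlinarith
  have hr : η ^ ((G.natDegree : ℝ) / k - 2) ≤ x ^ ((G.natDegree : ℝ) / k - 2) :=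
    Real.rpow_le_rpow_of_nonpos hx0 (by linarith) he
  have hMx : 0 ≤ M * x ^ ((G.natDegree : ℝ) / k - 2) :=
    mul_nonneg hM (Real.rpow_pos_of_pos hx0 _).le
  calc polyRootFunDD G (k : ℝ)⁻¹ η * (ξ₂ - ξ₁)
      ≤ M * η ^ ((G.natDegree : ℝ) / k - 2) * (ξ₂ - ξ₁) :=
        mul_le_mul_of_nonneg_right hle hgap.le
    _ ≤ M * x ^ ((G.natDegree : ℝ) / k - 2) * (z - x) :=
        mul_le_mul (mul_le_mul_of_nonneg_left hr hM) (by linarith) hgap.le hMx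

end Summit.Parity.BatemanHorn.Theorems
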